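import Mathlib
import Summits.Schanuel.Schanuel.Theorems.RigidCoreMinimalCounterexampleInAclLogSector
import Summits.Schanuel.Schanuel.Theorems.RigidCoreMinimalCounterexampleInAclOfSparsityTwo
import Literature.NumberTheory.Transcendental.TrdegZariskiDimConverse
import Literature.NumberTheory.Transcendental.ExpPointsLogTypePole
import Literature.NumberTheory.Transcendental.ExpPointsCuspTranscendence
import Literature.NumberTheory.Transcendental.ExpPointsConstantExponential
import Literature.NumberTheory.Transcendental.ExpPointsDegenerateSections
import Literature.NumberTheory.Transcendental.ExpPointsBranchLaurent
import Literature.Analysis.Complex.BranchOrders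
import Summits.Schanuel.Schanuel.Theorems.RigidCoreMinimalCounterexampleInAclWindowRecurrenceBranch

/-!
# Window recurrence is finite when `e^{x₀}` is algebraic — line `kernel-arithmetic-selection`, crux stmt-Schanuel-0969

Route `RigidCore`, crux (S*) `MinimalCounterexampleInAcl`, lead prover-line-stmt-Schanuel-0969-c3-0, registered stub
`stub_windowRecurrence_e0` (`--supports stmt-Schanuel-0969`).

For an off-log rank-2 first failure `x` with `e^{x₀} ∈ ℚ̄` the set `E = {x'₀ : x' ∈ locusMates x}` lies on finitely many
cosets of `2πiℤ`; this file proves that LONG WINDOWS RECUR FINITELY OFTEN in `E`: there is `L` such that for every finite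
`G ⊆ ℤ` with `|G| ≥ L` only finitely many `s` have `s + 2πig ∈ E` for all `g ∈ G`.  Structure:

* `branch_window_finite` — ON ONE BRANCH AT INFINITY `𝔟(t) = ((t⁻ᵉ, Φ₁ t/tᴺ), (Φ₂ t/tᴺ, Φ₃ t/tᴺ)) ⊆ W` of the ℚ-curve
  `W ∋ (x, eˣ)` over one coset `c + 2πiℤ` (hits at the principal root `t = x₀^{−1/e}`): if the branch carries infinitely
  many coset hits then `y₀ ≡ eᶜ` on it, a log-type `y₁` is impossible (`false_of_logType_pole`), so `y₁ = e^{ℓ₁(t)}` and the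
  hits are the `k` with `M(t_k) ∈ 2πiℤ` for the MEROMORPHIC phase `M = x₁ − ℓ₁`; if `M` were a polynomial in `t⁻ᵉ = x₀`,
  `e^{ℓ₁}` and `ℓ₁` would both be algebraic over `ℂ[x̂₀]` (`isAlgebraic_coords_of_branch`), forcing `ℓ₁` constant
  (`eventually_const_of_isAlgebraic_exp`) and infinitely many independent points in one fibre `eˣ = ω`
  (`finite_indepExpPoints_fibre`) — so `M` is non-degenerate and the COSET WINDOW RIGIDITY (registered stub
  `stub_windowRigidity_coset`, taken as a hypothesis here) bounds the recurrences;
* `windowRecurrence_e0_of` — the assembly over the finitely many cosets (`exp '' E` finite) and the finitely many branches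
  covering the large coset hits (registered stub `stub_cosetBranchCover`, taken as a hypothesis), with a pigeonhole from a
  long window to a long same-branch sub-window;
* `stub_windowRecurrence_e0` — the registered form, from the two stubs once landed.

References: card `Cruxes/MinimalCounterexampleInAcl/Ideas/torsor-self-selection.md` (crux-ideate r1, ideator 2); the tree's
cusp machinery `Literature/NumberTheory/Transcendental/ExpPoints*.lean` (line cusp-germ-schneider-sparsity of crux 0971).
-/

noncomputable section

set_option linter.dupNamespace false

open Complex Filter Topology Set Metric Polynomial

namespace Summit.Schanuel.Schanuel.Cruxes.MinimalCounterexampleInAcl.KernelArithmeticSelection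

open Literature.NumberTheory.Transcendental
open Literature.Analysis.Complex.LaurentGerm
open Literature.Analysis.Complex.MeromorphicGerm (analyticAt_pow_succ_mul_div_pow analyticAt_pow_succ_mul_inv_pow)
open Literature.Analysis.Complex.BranchOrders (exists_zpow_exp_form)
open Summit.Schanuel.Schanuel.Theorems (mem_of_isDefinedOver_bot_of_relations)

/-- The Taylor series of `f : ℂ → ℂ` at `0`, as a formal power series (local notation, as in the tree's cusp files). -/
local notation3 "𝓣[" f "]" =>
  (PowerSeries.mk fun n => ((Nat.factorial n : ℂ)⁻¹ * iteratedDeriv n f 0) : PowerSeries ℂ)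

/-- The Laurent expansion at `0` of a germ `f` with `zⁿ f(z)` analytic at `0` (local notation). -/
local notation3 "𝓛[" n ", " f "]" =>
  (HahnSeries.single (-((n : ℕ) : ℤ)) (1 : ℂ) *
    HahnSeries.ofPowerSeries ℤ ℂ 𝓣[fun z : ℂ => z ^ (n : ℕ) * (f : ℂ → ℂ) z] : LaurentSeries ℂ)

/-- The branch point `((t⁻ᵉ, Φ₁ t / tᴺ), (Φ₂ t / tᴺ, Φ₃ t / tᴺ)) ∈ ℂ² × ℂ²` (local notation). -/
local notation3 "𝔟[" e ", " N ", " Φ₁ ", " Φ₂ ", " Φ₃ ", " t "]" =>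
  (Sum.elim ![((t : ℂ) ^ (e : ℕ))⁻¹, (Φ₁ : ℂ → ℂ) t / t ^ (N : ℕ)]
    ![(Φ₂ : ℂ → ℂ) t / t ^ (N : ℕ), (Φ₃ : ℂ → ℂ) t / t ^ (N : ℕ)] : Fin 2 ⊕ Fin 2 → ℂ)

/-! ## Assembly over cosets and branches -/

section Assembly

/-- Recovering the integer parameter of a coset point. [folklore] -/
theorem round_coset (c : ℂ) (m : ℤ) :
    round (((c + 2 * ↑Real.pi * I * (m : ℂ) - c) / (2 * ↑Real.pi * I)).re) = m := by
  have hne : (2 * ↑Real.pi * I : ℂ) ≠ 0 := by simp [Real.pi_ne_zero, I_ne_zero]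
  have : (c + 2 * ↑Real.pi * I * (m : ℂ) - c) / (2 * ↑Real.pi * I) = (m : ℂ) := by
    field_simp; ring
  rw [this, Complex.intCast_re, round_intCast]

/-- Finitely many coset positions are first coordinates of points of a finite set. [folklore] -/
theorem finite_coset_positions_of_finite {X : Set (Fin 2 → ℂ)} (hX : X.Finite) (c : ℂ) :
    Set.Finite {m : ℤ | ∃ x ∈ X, x 0 = c + 2 * ↑Real.pi * I * (m : ℂ)} := by
  refine (hX.image fun x : Fin 2 → ℂ => round (((x 0 - c) / (2 * ↑Real.pi * I)).re)).subset ?_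
  rintro m ⟨x, hx, hx0⟩
  refine ⟨x, hx, ?_⟩
  simp only
  rw [hx0, round_coset]

/-- Mates of a tuple with `e^{x₀}` algebraic have `e^{x'₀}` among the roots of its minimal relation. [folklore] -/
theorem cexp_fst_mem_rootSet_of_mem_locusMates {x : Fin 2 → ℂ} {p : Polynomial ℚ}
    (hp : Polynomial.aeval (cexp (x 0)) p = 0) {x' : Fin 2 → ℂ} (hx' : x' ∈ locusMates x) (hp0 : p ≠ 0) :
    cexp (x' 0) ∈ p.rootSet ℂ := by
  set P : MvPolynomial (Fin 2 ⊕ Fin 2) ℚ :=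
    Polynomial.aeval (MvPolynomial.X (Sum.inr 0) : MvPolynomial (Fin 2 ⊕ Fin 2) ℚ) p with hP
  have hPev : ∀ z : Fin 2 → ℂ, MvPolynomial.aeval (Sum.elim z (cexp ∘ z)) P = Polynomial.aeval (cexp (z 0)) p := by
    intro z
    have h := Polynomial.aeval_algHom_apply (MvPolynomial.aeval (Sum.elim z (cexp ∘ z)))
      (MvPolynomial.X (Sum.inr 0) : MvPolynomial (Fin 2 ⊕ Fin 2) ℚ) p
    rw [MvPolynomial.aeval_X] at h
    rw [hP, ← h]
    simp
  have h0 : MvPolynomial.aeval (Sum.elim x (cexp ∘ x)) P = 0 := by rw [hPev, hp]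
  have h1 : MvPolynomial.aeval (Sum.elim x' (cexp ∘ x')) P = 0 := hx'.2 P h0
  rw [hPev] at h1
  rw [Polynomial.mem_rootSet]
  exact ⟨hp0, h1⟩

/-- **Window recurrence is finite when `e^{x₀}` is algebraic**, from the coset window rigidity (`hrig`, registered stub
`stub_windowRigidity_coset`) and the branch cover of the large coset hits (`hcov`, registered stub `stub_cosetBranchCover`).
See the module docstring. [folklore] -/
theorem windowRecurrence_e0_of
    (hrig : ∀ (e p : ℕ) (M : ℂ → ℂ) (c : ℂ) (G : Finset ℤ), 0 < e → AnalyticAt ℂ (fun t : ℂ => t ^ p * M t) 0 →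
      (¬ ∃ Q : Polynomial ℂ, ∀ᶠ t in 𝓝[≠] (0 : ℂ), M t = Q.eval (t ^ e)⁻¹) → p + 2 ≤ G.card →
        Set.Finite {k : ℤ | ∀ j ∈ G, ∃ L : ℤ,
          M ((c + 2 * ↑Real.pi * I * ((k + j : ℤ) : ℂ)) ^ (-((e : ℂ)⁻¹))) = (L : ℂ) * (2 * ↑Real.pi * I)})
    (hcov : ∀ (W : Set (Fin 2 ⊕ Fin 2 → ℂ)), IsZariskiClosed ℂ W → zariskiDim ℂ W < 2 → ∀ (c : ℂ),
      ∃ (e : ℕ) (R r : ℝ) (B : Finset ((ℂ → ℂ) × (ℂ → ℂ) × (ℂ → ℂ) × ℕ)) (X : Set (Fin 2 → ℂ)),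
        0 < e ∧ 0 < r ∧ X.Finite ∧
        (∀ b ∈ B, (∀ t : ℂ, ‖t‖ < r → AnalyticAt ℂ b.1 t ∧ AnalyticAt ℂ b.2.1 t ∧ AnalyticAt ℂ b.2.2.1 t) ∧
          ∀ t : ℂ, 0 < ‖t‖ → ‖t‖ < r →
            (Sum.elim ![(t ^ e)⁻¹, b.1 t / t ^ b.2.2.2] ![b.2.1 t / t ^ b.2.2.2, b.2.2.1 t / t ^ b.2.2.2] :
              Fin 2 ⊕ Fin 2 → ℂ) ∈ W) ∧
        ∀ x ∈ indepExpPoints W, (∃ k : ℤ, x 0 = c + 2 * ↑Real.pi * I * (k : ℂ)) → R < ‖x 0‖ → x ∉ X →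
          ∃ b ∈ B, 0 < ‖(x 0) ^ (-((e : ℂ)⁻¹))‖ ∧ ‖(x 0) ^ (-((e : ℂ)⁻¹))‖ < r ∧
            Sum.elim x (cexp ∘ x) =
              (Sum.elim ![(((x 0) ^ (-((e : ℂ)⁻¹))) ^ e)⁻¹, b.1 ((x 0) ^ (-((e : ℂ)⁻¹))) / ((x 0) ^ (-((e : ℂ)⁻¹))) ^ b.2.2.2]
                ![b.2.1 ((x 0) ^ (-((e : ℂ)⁻¹))) / ((x 0) ^ (-((e : ℂ)⁻¹))) ^ b.2.2.2,
                  b.2.2.1 ((x 0) ^ (-((e : ℂ)⁻¹))) / ((x 0) ^ (-((e : ℂ)⁻¹))) ^ b.2.2.2] : Fin 2 ⊕ Fin 2 → ℂ))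
    {x : Fin 2 → ℂ} (hx : x ∈ firstFailures 2) (halg : IsAlgebraic ℚ (cexp (x 0))) :
    ∃ L : ℕ, ∀ G : Finset ℤ, L ≤ G.card →
      Set.Finite {s : ℂ | ∀ g ∈ G, s + 2 * ↑Real.pi * I * (g : ℂ) ∈ {s : ℂ | ∃ x' ∈ locusMates x, s = x' 0}} := by
  classical
  -- the ℚ-curve through `(x, eˣ)` and its independent exponential points
  obtain ⟨W, hW, hd, hxW⟩ := exists_mem_indepExpPoints_of_trdeg_lt_two hx.1 (by exact_mod_cast hx.2.1)
  have hmate : ∀ x' ∈ locusMates x, x' ∈ indepExpPoints W :=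
    fun x' hx' => ⟨hx'.1, mem_of_isDefinedOver_bot_of_relations hW hxW.2 hx'.2⟩
  -- the finitely many exponential values of the first coordinates of mates
  obtain ⟨p, hp0, hp⟩ := halg
  set Rt : Finset ℂ := (p.rootSet_finite ℂ).toFinset with hRt
  have hroot : ∀ x' ∈ locusMates x, cexp (x' 0) ∈ Rt := fun x' hx' => by
    rw [hRt, Set.Finite.mem_toFinset]; exact cexp_fst_mem_rootSet_of_mem_locusMates hp hx' hp0
  -- cover data for every value `ρ` (coset `log ρ + 2πiℤ`)
  have hcov' := fun ρ : ℂ => hcov W hW.isZariskiClosed hd (Complex.log ρ)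
  choose eρ Rρ rρ Bρ Xρ heρ hrρ hXρ hBρ hrepρ using hcov'
  -- per-branch window bounds
  have hbr : ∀ (ρ : ℂ) (b : (ℂ → ℂ) × (ℂ → ℂ) × (ℂ → ℂ) × ℕ), b ∈ Bρ ρ → ∃ L : ℕ, ∀ G : Finset ℤ, L ≤ G.card →
      Set.Finite {k : ℤ | ∀ j ∈ G, ∃ x' ∈ indepExpPoints W, ∃ t : ℂ,
        t = (x' 0) ^ (-((eρ ρ : ℂ)⁻¹)) ∧ x' 0 = Complex.log ρ + 2 * ↑Real.pi * I * ((k + j : ℤ) : ℂ) ∧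
        0 < ‖t‖ ∧ ‖t‖ < rρ ρ ∧ Sum.elim x' (cexp ∘ x') = 𝔟[eρ ρ, b.2.2.2, b.1, b.2.1, b.2.2.1, t]} := by
    intro ρ b hb
    obtain ⟨hban, hbW⟩ := hBρ ρ b hb
    exact branch_window_finite hrig hW hd (heρ ρ) (hrρ ρ) hban hbW (Complex.log ρ)
  choose! Lb hLb using hbr
  -- the global window length
  set maxL : ℂ → ℕ := fun ρ => (Bρ ρ).sup (Lb ρ) with hmaxL
  set Lρ : ℂ → ℕ := fun ρ => (Bρ ρ).card * maxL ρ + 1 with hLρ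
  refine ⟨Rt.sup Lρ + 1, fun G hG => ?_⟩
  have hGne : G.Nonempty := Finset.card_pos.1 (by omega)
  obtain ⟨g₀, hg₀⟩ := hGne
  set E : Set ℂ := {s : ℂ | ∃ x' ∈ locusMates x, s = x' 0} with hE
  -- windows sit on one of the finitely many cosets
  set Kρ : ℂ → Set ℤ := fun ρ => {k : ℤ | ∀ g ∈ G, Complex.log ρ + 2 * ↑Real.pi * I * ((k + g : ℤ) : ℂ) ∈ E} with hKρ
  have hcover : {s : ℂ | ∀ g ∈ G, s + 2 * ↑Real.pi * I * (g : ℂ) ∈ E} ⊆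
      ⋃ ρ ∈ Rt, (fun k : ℤ => Complex.log ρ + 2 * ↑Real.pi * I * (k : ℂ)) '' Kρ ρ := by
    intro s hs
    obtain ⟨x', hx', hsx'⟩ := hs g₀ hg₀
    set ρ : ℂ := cexp s with hρ
    have hρmem : ρ ∈ Rt := by
      have h := hroot x' hx'
      rwa [← hsx', Complex.exp_add, mul_comm (2 * ↑Real.pi * I) (g₀ : ℂ), Complex.exp_int_mul_two_pi_mul_I,
        mul_one] at h
    have hρ0 : ρ ≠ 0 := Complex.exp_ne_zero s
    obtain ⟨k, hk⟩ : ∃ k : ℤ, s = Complex.log ρ + k * (2 * ↑Real.pi * I) :=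
      Complex.exp_eq_exp_iff_exists_int.1 (by rw [Complex.exp_log hρ0])
    refine Set.mem_iUnion₂.2 ⟨ρ, hρmem, k, ?_, ?_⟩
    · intro g hg
      have := hs g hg
      rw [hk] at this
      convert this using 1
      push_cast; ring
    · rw [hk]; ring
  refine (Set.Finite.biUnion Rt.finite_toSet fun ρ hρ => (Set.Finite.image _ ?_)).subset hcover
  -- ### finiteness of the window recurrences on the coset of `ρ`
  have hLρle : Lρ ρ + 1 ≤ G.card := (Nat.add_le_add_right (Finset.le_sup hρ) 1).trans hG
  -- bad positions: small first coordinate or exceptional point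
  set Bad : Set ℤ := ⋃ g ∈ G, ({k : ℤ | ‖Complex.log ρ + 2 * ↑Real.pi * I * ((k + g : ℤ) : ℂ)‖ ≤ Rρ ρ} ∪
      {k : ℤ | ∃ x' ∈ Xρ ρ, x' 0 = Complex.log ρ + 2 * ↑Real.pi * I * ((k + g : ℤ) : ℂ)}) with hBad
  have hBadfin : Bad.Finite := by
    refine Set.Finite.biUnion G.finite_toSet fun g _ => Set.Finite.union ?_ ?_
    · exact (finite_int_norm_coset_le (Complex.log ρ) (Rρ ρ)).preimage (f := fun k : ℤ => k + g)
        (add_left_injective g).injOn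
    · exact (finite_coset_positions_of_finite (hXρ ρ) (Complex.log ρ)).preimage (f := fun k : ℤ => k + g)
        (add_left_injective g).injOn
  -- good windows: a long same-branch sub-window
  set Rec : ((ℂ → ℂ) × (ℂ → ℂ) × (ℂ → ℂ) × ℕ) → Finset ℤ → Set ℤ := fun b G' =>
      {k : ℤ | ∀ j ∈ G', ∃ x' ∈ indepExpPoints W, ∃ t : ℂ,
        t = (x' 0) ^ (-((eρ ρ : ℂ)⁻¹)) ∧ x' 0 = Complex.log ρ + 2 * ↑Real.pi * I * ((k + j : ℤ) : ℂ) ∧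
        0 < ‖t‖ ∧ ‖t‖ < rρ ρ ∧ Sum.elim x' (cexp ∘ x') = 𝔟[eρ ρ, b.2.2.2, b.1, b.2.1, b.2.2.1, t]} with hRec
  have hRecfin : Set.Finite (⋃ b ∈ Bρ ρ, ⋃ G' ∈ G.powerset.filter (fun G' => Lb ρ b ≤ G'.card), Rec b G') := by
    refine Set.Finite.biUnion (Bρ ρ).finite_toSet fun b hb => Set.Finite.biUnion (Finset.finite_toSet _) fun G' hG' => ?_
    rw [Finset.coe_filter, Set.mem_setOf_eq] at hG'
    exact hLb ρ b hb G' hG'.2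
  refine (hBadfin.union hRecfin).subset ?_
  intro k hk
  by_cases hkB : k ∈ Bad
  · exact Or.inl hkB
  refine Or.inr ?_
  -- every position of the window is a large non-exceptional coset hit, hence on a branch
  have hpos : ∀ g ∈ G, ∃ b ∈ Bρ ρ, ∃ x' ∈ indepExpPoints W, ∃ t : ℂ,
      t = (x' 0) ^ (-((eρ ρ : ℂ)⁻¹)) ∧ x' 0 = Complex.log ρ + 2 * ↑Real.pi * I * ((k + g : ℤ) : ℂ) ∧
      0 < ‖t‖ ∧ ‖t‖ < rρ ρ ∧ Sum.elim x' (cexp ∘ x') = 𝔟[eρ ρ, b.2.2.2, b.1, b.2.1, b.2.2.1, t] := by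
    intro g hg
    obtain ⟨x', hx', hx'0⟩ := hk g hg
    have hxI : x' ∈ indepExpPoints W := hmate x' hx'
    have hlarge : Rρ ρ < ‖x' 0‖ := by
      by_contra hle
      refine hkB (Set.mem_iUnion₂.2 ⟨g, hg, Or.inl ?_⟩)
      show ‖Complex.log ρ + 2 * ↑Real.pi * I * ((k + g : ℤ) : ℂ)‖ ≤ Rρ ρ
      rw [hx'0]; exact not_lt.1 hle
    have hnotX : x' ∉ Xρ ρ := fun hX =>
      hkB (Set.mem_iUnion₂.2 ⟨g, hg, Or.inr ⟨x', hX, hx'0.symm⟩⟩)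
    obtain ⟨b, hb, ht0, htr, hrepr⟩ := hrepρ ρ x' hxI ⟨k + g, hx'0.symm⟩ hlarge hnotX
    exact ⟨b, hb, x', hxI, (x' 0) ^ (-((eρ ρ : ℂ)⁻¹)), rfl, hx'0.symm, ht0, htr, hrepr⟩
  choose! σ hσB hσ using hpos
  -- pigeonhole over the branches
  have hfib : ∃ b ∈ Bρ ρ, maxL ρ < (G.filter (fun g => σ g = b)).card := by
    by_contra hcon
    push Not at hcon
    have hsum : G.card = ∑ b ∈ Bρ ρ, (G.filter (fun g => σ g = b)).card :=
      Finset.card_eq_sum_card_fiberwise fun g hg => hσB g hg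
    have hle : ∑ b ∈ Bρ ρ, (G.filter (fun g => σ g = b)).card ≤ (Bρ ρ).card * maxL ρ := by
      calc ∑ b ∈ Bρ ρ, (G.filter (fun g => σ g = b)).card ≤ ∑ _b ∈ Bρ ρ, maxL ρ := Finset.sum_le_sum hcon
        _ = (Bρ ρ).card * maxL ρ := by rw [Finset.sum_const, smul_eq_mul]
    have h1 : Lρ ρ + 1 ≤ (Bρ ρ).card * maxL ρ := hLρle.trans (hsum ▸ hle)
    have h2 : Lρ ρ = (Bρ ρ).card * maxL ρ + 1 := rfl
    omega
  obtain ⟨b₀, hb₀, hcard⟩ := hfib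
  set G' : Finset ℤ := G.filter (fun g => σ g = b₀) with hG'
  have hLb₀ : Lb ρ b₀ ≤ G'.card := (Finset.le_sup (f := Lb ρ) hb₀).trans hcard.le
  refine Set.mem_iUnion₂.2 ⟨b₀, hb₀, Set.mem_iUnion₂.2 ⟨G', ?_, ?_⟩⟩
  · rw [Finset.mem_filter, Finset.mem_powerset]
    exact ⟨Finset.filter_subset _ _, hLb₀⟩
  · intro j hj
    rw [hG', Finset.mem_filter] at hj
    obtain ⟨hjG, hjb⟩ := hj
    have h := hσ j hjG
    rw [hjb] at h
    exact h

end Assembly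

/-! ## Registered forms -/

/-- **Registered stub `stub_windowRecurrenceCore` (PROVED): window recurrence is finite when `e^{x₀}` is algebraic, from the
coset window rigidity and the coset branch cover** (both registered stubs of the skeleton, here the two hypotheses; see
`windowRecurrence_e0_of`). [folklore] -/
theorem stub_windowRecurrenceCore : (∀ (e p : ℕ) (M : ℂ → ℂ) (c : ℂ) (G : Finset ℤ), 0 < e → AnalyticAt ℂ (fun t : ℂ => t ^ p * M t) 0 → (¬ ∃ Q : Polynomial ℂ, ∀ᶠ t in 𝓝[≠] (0 : ℂ), M t = Q.eval (t ^ e)⁻¹) → p + 2 ≤ G.card → Set.Finite {k : ℤ | ∀ j ∈ G, ∃ L : ℤ, M ((c + 2 * ↑Real.pi * Complex.I * ((k + j : ℤ) : ℂ)) ^ (-((e : ℂ)⁻¹))) = (L : ℂ) * (2 * ↑Real.pi * Complex.I)}) → (∀ (W : Set (Fin 2 ⊕ Fin 2 → ℂ)), Literature.NumberTheory.Transcendental.IsZariskiClosed ℂ W → Literature.NumberTheory.Transcendental.zariskiDim ℂ W < 2 → ∀ (c : ℂ), ∃ (e : ℕ) (R r : ℝ) (B : Finset ((ℂ → ℂ)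 × (ℂ → ℂ) × (ℂ → ℂ) × ℕ)) (X : Set (Fin 2 → ℂ)), 0 < e ∧ 0 < r ∧ X.Finite ∧ (∀ b ∈ B, (∀ t : ℂ, ‖t‖ < r → AnalyticAt ℂ b.1 t ∧ AnalyticAt ℂ b.2.1 t ∧ AnalyticAt ℂ b.2.2.1 t) ∧ ∀ t : ℂ, 0 < ‖t‖ → ‖t‖ < r → (Sum.elim ![(t ^ e)⁻¹, b.1 t / t ^ b.2.2.2] ![b.2.1 t / t ^ b.2.2.2, b.2.2.1 t / t ^ b.2.2.2] : Fin 2 ⊕ Fin 2 → ℂ) ∈ W) ∧ ∀ x ∈ Literature.NumberTheory.Transcendental.indepExpPoints W, (∃ k : ℤ, x 0 = c + 2 * ↑Real.pi * Complex.I * (k : ℂ)) → R < ‖x 0‖ → x ∉ X → ∃ b ∈ B, 0 < ‖(x 0) ^ (-((e : ℂ)⁻¹))‖ ∧ ‖(x 0) ^ (-((e : ℂ)⁻¹))‖ < r ∧ Sum.elim x (Complex.exp ∘ x) = (Sum.elim ![(((x 0) ^ (-((e : ℂ)⁻¹))) ^ e)⁻¹, b.1 ((x 0) ^ (-((e : ℂ)⁻¹)))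 / ((x 0) ^ (-((e : ℂ)⁻¹))) ^ b.2.2.2] ![b.2.1 ((x 0) ^ (-((e : ℂ)⁻¹))) / ((x 0) ^ (-((e : ℂ)⁻¹))) ^ b.2.2.2, b.2.2.1 ((x 0) ^ (-((e : ℂ)⁻¹))) / ((x 0) ^ (-((e : ℂ)⁻¹))) ^ b.2.2.2] : Fin 2 ⊕ Fin 2 → ℂ)) → ∀ (x : Fin 2 → ℂ), x ∈ Summit.Schanuel.Schanuel.Cruxes.MinimalCounterexampleInAcl.KernelArithmeticSelection.firstFailures 2 → IsAlgebraic ℚ (Complex.exp (x 0)) → ∃ L : ℕ, ∀ G : Finset ℤ, L ≤ G.card → Set.Finite {s : ℂ | ∀ g ∈ G, s + 2 * ↑Real.pi * Complex.I * (g : ℂ) ∈ {s : ℂ | ∃ x' ∈ Summit.Schanuel.Schanuel.Cruxes.MinimalCounterexampleInAcl.KernelArithmeticSelection.locusMates x, s = x' 0}} :=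
  fun hrig hcov _ hx halg => windowRecurrence_e0_of hrig hcov hx halg

end Summit.Schanuel.Schanuel.Cruxes.MinimalCounterexampleInAcl.KernelArithmeticSelection

end
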